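import Literature.Analysis.FunctionSpaces.TorusTrigPoly
import Literature.Analysis.FunctionSpaces.TorusVectorParseval
import HarnessLib

/-!
# Real scalar trigonometric polynomials and the Fourier truncation of real scalars on `T^d`

Trunk: Sobolev / function spaces on `T^d = UnitAddTorus d`. Scalar companion of the vector-valued
`Torus.realTrigPoly` / `Torus.fourierTruncate` calculus of `TorusTrigPoly` (there for
`EuclideanSpace ℝ d`-valued fields, here for real scalars `θ : T^d → ℝ`), as needed by the
Fourier–Galerkin energy argument for the passive scalar equation
(`Literature/Analysis/FluidPDE/PassiveScalarEnergyProofs`): the truncations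
`P_N θ = Re ∑_{|k| ≤ N} θ̂(k) e_k` are the smooth functions whose `L²` energy balance is summed
mode by mode, and the three numbers entering that balance are read off the coefficients —
`‖P_N θ‖²_{L²} = ∑_{|k|≤N} |θ̂(k)|²`, `‖∇P_N θ‖²_{L²} = 4π² ∑_{|k|≤N} |k|² |θ̂(k)|²` and the
Parseval tail `‖θ - P_N θ‖²_{L²} = ‖θ‖²_{L²} - ∑_{|k|≤N} |θ̂(k)|² → 0`
(Grafakos 2014, Prop. 3.2.7 (3) and Prop. 3.2.6 (8); Robinson–Rodrigo–Sadowski 2016, Lemma 4.1).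

## Contents (all proved)

* `Torus.IsConjSymmScalar c` (`c (-k) = conj (c k)`), satisfied by the Fourier coefficients of a
  real scalar (`Torus.isConjSymmScalar_mFourierCoeff`, Grafakos Prop. 3.2.6 (4)); on a symmetric
  frequency set such a `trigPoly S c` is real valued (`Torus.conj_trigPoly_apply`,
  `Torus.ofReal_reTrigPoly`).
* `Torus.reTrigPoly S c = Re ∘ trigPoly S c` — smooth; partial derivatives
  (`∂ⱼ ↦ 2πi kⱼ`), gradient in coordinates, Laplacian (`Δ ↦ -4π²|k|²`); its `L²` norm
  `∫ (reTrigPoly S c)² = ∑_{k∈S} |c k|²` and gradient norm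
  `∫ ‖∇ reTrigPoly S c‖² = 4π² ∑_{k∈S} |k|² |c k|²` (conjugate-symmetric `c`, symmetric `S`).
* `Torus.scalarTruncate N θ = reTrigPoly (freqBall N) θ̂` — the Fourier truncation `P_N θ` of a
  real scalar: smooth, bounded in `L²` by `θ` (Bessel), with the **Parseval tail identity**
  `∫ (θ - P_N θ)² = ∫ θ² - ∑_{|k|≤N} |θ̂(k)|²` for `θ ∈ L²` and `∫ (θ - P_N θ)² → 0`.

## Mathlib search

Mathlib (this pin) has `UnitAddTorus.mFourier`, `mFourierCoeff`, `hasSum_sq_mFourierCoeff` (for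
`Lp` elements, local Haar volume) and nothing on trigonometric polynomials as functions or their
derivatives (searched `trigPoly`, `truncat`); the tree's `TorusTrigPoly` is vector valued. All
statements here are bookkeeping over `TorusTrigPoly`, `TorusVectorParseval`,
`TorusCalculusProofs`.

## References

* L. Grafakos, *Classical Fourier Analysis*, 3rd ed., GTM 249 (2014), §3.1.1 (3.1.5),
  Prop. 3.2.6 (4), (8), Prop. 3.2.7 (3).
* J. C. Robinson, J. L. Rodrigo, W. Sadowski, *The three-dimensional Navier–Stokes equations*,
  CUP 2016, Lemma 4.1 (the truncations `P_n`, `P_n u → u` in `L²`).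
-/

open MeasureTheory Set Filter Topology UnitAddTorus
open scoped ENNReal NNReal InnerProductSpace ContDiff ComplexConjugate

noncomputable section

namespace Literature.Analysis.FunctionSpaces

namespace Torus

variable {d : Type*} [Fintype d]

/-! ## Conjugate symmetry of scalar coefficient families -/

section ConjSymm

/-- **Conjugate symmetry** of a scalar coefficient family on `ℤ^d`: `c (-k) = conj (c k)` — the
reality condition on Fourier coefficients (Grafakos 2014, Prop. 3.2.6 (4)). [folklore] -/
def IsConjSymmScalar (c : (d → ℤ) → ℂ) : Prop :=
  ∀ k, c (-k) = conj (c k)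

/-- The Fourier coefficients of a real scalar are conjugate symmetric
(`Torus.mFourierCoeff_ofReal_comp`; Grafakos 2014, Prop. 3.2.6 (4)). [cite: Grafakos2014, Prop. 3.2.6 (4)] -/
theorem isConjSymmScalar_mFourierCoeff (θ : UnitAddTorus d → ℝ) :
    IsConjSymmScalar (fun k => mFourierCoeff (fun x => (θ x : ℂ)) k) :=
  fun k => mFourierCoeff_ofReal_comp θ k

omit [Fintype d] in
/-- Conjugate symmetry is preserved by the diagonal action of `∂ⱼ`, `c k ↦ (2πi kⱼ) • c k`. [folklore] -/
theorem IsConjSymmScalar.deriv {c : (d → ℤ) → ℂ} (hc : IsConjSymmScalar c) (j : d) :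
    IsConjSymmScalar (fun k => (2 * Real.pi * Complex.I * (k j)) • c k) := by
  intro k
  simp only [Pi.neg_apply, Int.cast_neg, smul_eq_mul, map_mul, hc k, Complex.conj_I,
    Complex.conj_ofReal, map_ofNat, map_intCast]
  ring

omit [Fintype d] in
/-- Conjugate symmetry is preserved by multiplication with a real, even weight. [folklore] -/
theorem IsConjSymmScalar.real_smul {c : (d → ℤ) → ℂ} (hc : IsConjSymmScalar c) {w : (d → ℤ) → ℝ}
    (hw : ∀ k, w (-k) = w k) : IsConjSymmScalar (fun k => ((w k : ℝ) : ℂ) • c k) := by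
  intro k
  simp only [smul_eq_mul, map_mul, Complex.conj_ofReal, hc k, hw k]

/-- On a symmetric frequency set, a scalar trigonometric polynomial with conjugate-symmetric
coefficients takes real values: `conj (trigPoly S c x) = trigPoly S c x`. [folklore] -/
theorem conj_trigPoly_apply {S : Finset (d → ℤ)} (hS : ∀ k ∈ S, -k ∈ S) {c : (d → ℤ) → ℂ}
    (hc : IsConjSymmScalar c) (x : UnitAddTorus d) :
    conj (trigPoly S c x) = trigPoly S c x := by
  have hc' : ∀ k, conj (c k) = c (-k) := fun k => (hc k).symm
  rw [trigPoly_apply, map_sum]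
  simp_rw [smul_eq_mul, map_mul, ← mFourier_neg, hc']
  exact Finset.sum_nbij' (fun k => -k) (fun k => -k) hS hS (fun k _ => neg_neg k)
    (fun k _ => neg_neg k) fun k _ => rfl

/-- Real-valuedness, `im` form: `Im (trigPoly S c x) = 0`. [folklore] -/
theorem im_trigPoly_apply {S : Finset (d → ℤ)} (hS : ∀ k ∈ S, -k ∈ S) {c : (d → ℤ) → ℂ}
    (hc : IsConjSymmScalar c) (x : UnitAddTorus d) : (trigPoly S c x).im = 0 :=
  Complex.conj_eq_iff_im.1 (conj_trigPoly_apply hS hc x)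

end ConjSymm

/-! ## Real scalar trigonometric polynomials -/

section ReTrigPoly

/-- The **real scalar trigonometric polynomial** `Re ∑_{k ∈ S} c k e_k` with coefficient family
`c : ℤ^d → ℂ` over the finite frequency set `S` (Grafakos 2014, §3.1.1; for conjugate-symmetric
`c` on a symmetric `S` no information is lost, `ofReal_reTrigPoly`). [folklore] -/
def reTrigPoly (S : Finset (d → ℤ)) (c : (d → ℤ) → ℂ) : UnitAddTorus d → ℝ :=
  fun x => (trigPoly S c x).re

/-- `reTrigPoly` as a pointwise sum of real parts: `reTrigPoly S c x = ∑_{k∈S} Re (e_k(x) c k)`. [folklore] -/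
theorem reTrigPoly_eq_sum (S : Finset (d → ℤ)) (c : (d → ℤ) → ℂ) (x : UnitAddTorus d) :
    reTrigPoly S c x = ∑ k ∈ S, (mFourier k x * c k).re := by
  show (trigPoly S c x).re = _
  rw [trigPoly_apply]
  simp only [smul_eq_mul, Complex.re_sum]

/-- Real scalar trigonometric polynomials are smooth. [folklore] -/
theorem isSmooth_reTrigPoly (S : Finset (d → ℤ)) (c : (d → ℤ) → ℂ) : IsSmooth (reTrigPoly S c) :=
  isSmooth_re_trigPoly S c

/-- Real scalar trigonometric polynomials are continuous. [folklore] -/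
theorem continuous_reTrigPoly (S : Finset (d → ℤ)) (c : (d → ℤ) → ℂ) :
    Continuous (reTrigPoly S c) :=
  (isSmooth_reTrigPoly S c).continuous

/-- Real scalar trigonometric polynomials lie in every `L^p`. [folklore] -/
theorem memLp_reTrigPoly (S : Finset (d → ℤ)) (c : (d → ℤ) → ℂ) (p : ℝ≥0∞) :
    MemLp (reTrigPoly S c) p volume :=
  (isSmooth_reTrigPoly S c).memLp p

/-- `reTrigPoly` is real-linear in the coefficients: finite real combinations. [folklore] -/
theorem reTrigPoly_sum_real_smul {ι : Type*} (T : Finset ι) (S : Finset (d → ℤ))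
    (a : ι → ℝ) (c : ι → (d → ℤ) → ℂ) (x : UnitAddTorus d) :
    reTrigPoly S (fun k => ∑ i ∈ T, ((a i : ℝ) : ℂ) * c i k) x = ∑ i ∈ T, a i * reTrigPoly S (c i) x := by
  simp only [reTrigPoly_eq_sum, Finset.mul_sum, Complex.re_sum]
  rw [Finset.sum_comm]
  refine Finset.sum_congr rfl fun i _ => Finset.sum_congr rfl fun k _ => ?_
  rw [mul_left_comm, Complex.re_ofReal_mul]

/-- **No information is lost in the real form**: for conjugate-symmetric coefficients on a
symmetric `S`, `(reTrigPoly S c x : ℂ) = trigPoly S c x`. [folklore] -/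
theorem ofReal_reTrigPoly {S : Finset (d → ℤ)} (hS : ∀ k ∈ S, -k ∈ S) {c : (d → ℤ) → ℂ}
    (hc : IsConjSymmScalar c) (x : UnitAddTorus d) :
    ((reTrigPoly S c x : ℝ) : ℂ) = trigPoly S c x :=
  Complex.conj_eq_iff_re.1 (conj_trigPoly_apply hS hc x)

/-- Pointwise squares: `(reTrigPoly S c x)² = ‖trigPoly S c x‖²` (conjugate-symmetric `c`,
symmetric `S`). [folklore] -/
theorem sq_reTrigPoly {S : Finset (d → ℤ)} (hS : ∀ k ∈ S, -k ∈ S) {c : (d → ℤ) → ℂ}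
    (hc : IsConjSymmScalar c) (x : UnitAddTorus d) :
    reTrigPoly S c x ^ 2 = ‖trigPoly S c x‖ ^ 2 := by
  rw [← ofReal_reTrigPoly hS hc x, Complex.norm_real, Real.norm_eq_abs, sq_abs]

/-- **Finite Parseval identity for real scalar trigonometric polynomials**:
`∫ (reTrigPoly S c)² = ∑_{k∈S} |c k|²` (conjugate-symmetric `c`, symmetric `S`;
Grafakos 2014, Prop. 3.2.7 (3)). [cite: Grafakos2014, Prop. 3.2.7 (3)] -/
theorem integral_sq_reTrigPoly {S : Finset (d → ℤ)} (hS : ∀ k ∈ S, -k ∈ S) {c : (d → ℤ) → ℂ}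
    (hc : IsConjSymmScalar c) : ∫ x, reTrigPoly S c x ^ 2 = ∑ k ∈ S, ‖c k‖ ^ 2 := by
  simp_rw [sq_reTrigPoly hS hc]
  exact integral_norm_sq_trigPoly S c

/-- The Fourier coefficients of `reTrigPoly S c` viewed in `ℂ`: `c k` on `S`, `0` off `S`
(conjugate-symmetric `c`, symmetric `S`). [cite: Grafakos2014, §3.1.1] -/
theorem mFourierCoeff_ofReal_reTrigPoly {S : Finset (d → ℤ)} (hS : ∀ k ∈ S, -k ∈ S)
    {c : (d → ℤ) → ℂ} (hc : IsConjSymmScalar c) (k : d → ℤ) :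
    mFourierCoeff (fun x => ((reTrigPoly S c x : ℝ) : ℂ)) k = if k ∈ S then c k else 0 := by
  rw [show (fun x => ((reTrigPoly S c x : ℝ) : ℂ)) = trigPoly S c from funext (ofReal_reTrigPoly hS hc),
    mFourierCoeff_trigPoly]

/-- A single mode: `reTrigPoly {m} c x = Re (e_m(x) c m)`. [folklore] -/
theorem reTrigPoly_singleton_apply (m : d → ℤ) (c : (d → ℤ) → ℂ) (x : UnitAddTorus d) :
    reTrigPoly {m} c x = (mFourier m x * c m).re := by
  rw [reTrigPoly_eq_sum, Finset.sum_singleton]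

/-- The cosine mode `Re e_{-k} = reTrigPoly {-k} 1`. [folklore] -/
theorem re_mFourier_neg (k : d → ℤ) (x : UnitAddTorus d) :
    (mFourier (-k) x).re = reTrigPoly {-k} (fun _ => 1) x := by
  rw [reTrigPoly_singleton_apply, mul_one]

/-- The sine mode `Im e_{-k} = reTrigPoly {-k} (-i)`. [folklore] -/
theorem im_mFourier_neg (k : d → ℤ) (x : UnitAddTorus d) :
    (mFourier (-k) x).im = reTrigPoly {-k} (fun _ => -Complex.I) x := by
  rw [reTrigPoly_singleton_apply]
  simp [Complex.mul_re]

/-- `Re (e_k(x) z) = Re z · Re e_{-k}(x) + Im z · Im e_{-k}(x)` (`e_{-k} = conj e_k`). [folklore] -/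
theorem re_mFourier_mul (k : d → ℤ) (x : UnitAddTorus d) (z : ℂ) :
    (mFourier k x * z).re = z.re * (mFourier (-k) x).re + z.im * (mFourier (-k) x).im := by
  rw [mFourier_neg, Complex.mul_re, Complex.conj_re, Complex.conj_im]
  ring

/-- **Decomposition into cosine and sine modes**:
`reTrigPoly S c = ∑_{k∈S} (Re (c k) · Re e_{-k} + Im (c k) · Im e_{-k})`. [folklore] -/
theorem reTrigPoly_eq_sum_re_im (S : Finset (d → ℤ)) (c : (d → ℤ) → ℂ) (x : UnitAddTorus d) :
    reTrigPoly S c x = ∑ k ∈ S, ((c k).re * reTrigPoly {-k} (fun _ => 1) x +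
      (c k).im * reTrigPoly {-k} (fun _ => -Complex.I) x) := by
  rw [reTrigPoly_eq_sum]
  refine Finset.sum_congr rfl fun k _ => ?_
  rw [re_mFourier_mul, re_mFourier_neg, im_mFourier_neg]

/-- The real part of a Fourier coefficient of a real scalar is its integral against the cosine
mode: `Re θ̂(k) = ∫ θ · Re e_{-k}` (`θ` integrable). [cite: Grafakos2014, §3.1.1] -/
theorem re_mFourierCoeff_ofReal {θ : UnitAddTorus d → ℝ} (hθ : Integrable θ volume) (k : d → ℤ) :
    (mFourierCoeff (fun x => (θ x : ℂ)) k).re = ∫ x, θ x * reTrigPoly {-k} (fun _ => 1) x := by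
  rw [mFourierCoeff_eq_integral_volume]
  have hi : Integrable (fun x => mFourier (-k) x • ((θ x : ℝ) : ℂ)) volume :=
    integrable_mFourier_smul' hθ.ofReal k
  have h := integral_re hi
  simp only [RCLike.re_to_complex] at h
  rw [← h]
  refine integral_congr_ae (ae_of_all _ fun x => ?_)
  simp only [smul_eq_mul, Complex.mul_re, Complex.ofReal_re, Complex.ofReal_im, mul_zero, sub_zero,
    re_mFourier_neg]
  ring

/-- The imaginary part of a Fourier coefficient of a real scalar is its integral against the sine
mode: `Im θ̂(k) = ∫ θ · Im e_{-k}` (`θ` integrable). [cite: Grafakos2014, §3.1.1] -/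
theorem im_mFourierCoeff_ofReal {θ : UnitAddTorus d → ℝ} (hθ : Integrable θ volume) (k : d → ℤ) :
    (mFourierCoeff (fun x => (θ x : ℂ)) k).im = ∫ x, θ x * reTrigPoly {-k} (fun _ => -Complex.I) x := by
  rw [mFourierCoeff_eq_integral_volume]
  have hi : Integrable (fun x => mFourier (-k) x • ((θ x : ℝ) : ℂ)) volume :=
    integrable_mFourier_smul' hθ.ofReal k
  have h := integral_im hi
  simp only [RCLike.im_to_complex] at h
  rw [← h]
  refine integral_congr_ae (ae_of_all _ fun x => ?_)
  simp only [smul_eq_mul, Complex.mul_im, Complex.ofReal_re, Complex.ofReal_im, mul_zero, zero_add,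
    im_mFourier_neg]
  ring

/-- The squared modulus of a Fourier coefficient of a real scalar as cosine and sine integrals:
`|θ̂(k)|² = (∫ θ Re e_{-k})² + (∫ θ Im e_{-k})²`. [folklore] -/
theorem sq_norm_mFourierCoeff_ofReal {θ : UnitAddTorus d → ℝ} (hθ : Integrable θ volume) (k : d → ℤ) :
    ‖mFourierCoeff (fun x => (θ x : ℂ)) k‖ ^ 2 =
      (∫ x, θ x * reTrigPoly {-k} (fun _ => 1) x) ^ 2 +
        (∫ x, θ x * reTrigPoly {-k} (fun _ => -Complex.I) x) ^ 2 := by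
  rw [← re_mFourierCoeff_ofReal hθ, ← im_mFourierCoeff_ofReal hθ, Complex.sq_norm, Complex.normSq_apply]
  ring

/-! ### Gradients of finite combinations -/

/-- The torus derivative of a finite sum of `C¹` functions. [folklore] -/
theorem fderiv_fun_sum {F : Type*} [NormedAddCommGroup F] [NormedSpace ℝ F] {ι : Type*} (T : Finset ι)
    {f : ι → UnitAddTorus d → F} (hf : ∀ i ∈ T, IsContDiff 1 (f i)) (x : UnitAddTorus d) :
    Torus.fderiv (fun y => ∑ i ∈ T, f i y) x = ∑ i ∈ T, Torus.fderiv (f i) x := by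
  unfold Torus.fderiv
  change _root_.fderiv ℝ (fun v => ∑ i ∈ T, liftAt (f i) x v) 0 = _
  exact _root_.fderiv_fun_sum fun i hi => (((hf i hi).liftAt x).differentiable one_ne_zero).differentiableAt

/-- The gradient of a finite sum of `C¹` scalar functions. [folklore] -/
theorem gradient_fun_sum {ι : Type*} (T : Finset ι) {f : ι → UnitAddTorus d → ℝ}
    (hf : ∀ i ∈ T, IsContDiff 1 (f i)) (x : UnitAddTorus d) :
    Torus.gradient (fun y => ∑ i ∈ T, f i y) x = ∑ i ∈ T, Torus.gradient (f i) x := by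
  refine ext_inner_right ℝ fun w => ?_
  rw [inner_gradient_left, fderiv_fun_sum T hf, sum_inner, _root_.sum_apply]
  exact Finset.sum_congr rfl fun i _ => (inner_gradient_left _ _ _).symm

/-- The gradient of a sum of two `C¹` scalar functions. [folklore] -/
theorem gradient_fun_add {f g : UnitAddTorus d → ℝ} (hf : IsContDiff 1 f) (hg : IsContDiff 1 g)
    (x : UnitAddTorus d) :
    Torus.gradient (fun y => f y + g y) x = Torus.gradient f x + Torus.gradient g x := by
  refine ext_inner_right ℝ fun w => ?_
  rw [inner_gradient_left, inner_add_left, inner_gradient_left, inner_gradient_left,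
    show (fun y => f y + g y) = f + g from rfl, Torus.fderiv_add hf hg]
  rfl

/-- The gradient of a constant multiple of a `C¹` scalar function: `∇(a f) = a ∇f`. [folklore] -/
theorem gradient_fun_const_mul {f : UnitAddTorus d → ℝ} (hf : IsContDiff 1 f) (a : ℝ)
    (x : UnitAddTorus d) : Torus.gradient (fun y => a * f y) x = a • Torus.gradient f x := by
  refine ext_inner_right ℝ fun w => ?_
  rw [inner_gradient_left, real_inner_smul_left, inner_gradient_left,
    show (fun y => a * f y) = a • f from rfl, fderiv_const_smul hf a]
  rfl

/-- **The gradient of a real trigonometric polynomial in cosine and sine modes**: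
`∇ reTrigPoly S c = ∑_{k∈S} (Re (c k) ∇Re e_{-k} + Im (c k) ∇Im e_{-k})`. [folklore] -/
theorem gradient_reTrigPoly_eq_sum_re_im (S : Finset (d → ℤ)) (c : (d → ℤ) → ℂ) (x : UnitAddTorus d) :
    Torus.gradient (reTrigPoly S c) x =
      ∑ k ∈ S, ((c k).re • Torus.gradient (reTrigPoly {-k} fun _ => 1) x +
        (c k).im • Torus.gradient (reTrigPoly {-k} fun _ => -Complex.I) x) := by
  have h1 : ∀ k, IsContDiff 1 (reTrigPoly ({-k} : Finset (d → ℤ)) fun _ => (1 : ℂ)) := fun k =>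
    (isSmooth_reTrigPoly _ _).isContDiff (by simp)
  have h2 : ∀ k, IsContDiff 1 (reTrigPoly ({-k} : Finset (d → ℤ)) fun _ => -Complex.I) := fun k =>
    (isSmooth_reTrigPoly _ _).isContDiff (by simp)
  have h : reTrigPoly S c = fun y => ∑ k ∈ S, ((c k).re * reTrigPoly {-k} (fun _ => 1) y +
      (c k).im * reTrigPoly {-k} (fun _ => -Complex.I) y) := funext (reTrigPoly_eq_sum_re_im S c)
  have h1' : ∀ k, IsContDiff 1 (fun y => (c k).re * reTrigPoly ({-k} : Finset (d → ℤ)) (fun _ => (1 : ℂ)) y) :=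
    fun k => (h1 k).smul (c k).re
  have h2' : ∀ k, IsContDiff 1 (fun y => (c k).im * reTrigPoly ({-k} : Finset (d → ℤ)) (fun _ => -Complex.I) y) :=
    fun k => (h2 k).smul (c k).im
  rw [h, gradient_fun_sum S (f := fun k y => (c k).re * reTrigPoly {-k} (fun _ => 1) y +
      (c k).im * reTrigPoly {-k} (fun _ => -Complex.I) y) (fun k _ => (h1' k).add (h2' k))]
  refine Finset.sum_congr rfl fun k _ => ?_
  rw [gradient_fun_add (h1' k) (h2' k), gradient_fun_const_mul (h1 k), gradient_fun_const_mul (h2 k)]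

variable [DecidableEq d]

/-- **Partial derivatives act diagonally**: `∂ⱼ reTrigPoly S c = reTrigPoly S (2πi kⱼ c)`
(Grafakos 2014, proof of Prop. 3.2.6 (8)). [folklore] -/
theorem partialDeriv_reTrigPoly (S : Finset (d → ℤ)) (c : (d → ℤ) → ℂ) (j : d) (x : UnitAddTorus d) :
    partialDeriv j (reTrigPoly S c) x =
      reTrigPoly S (fun k => (2 * Real.pi * Complex.I * (k j)) • c k) x :=
  partialDeriv_re_trigPoly S c j x

/-- The gradient in coordinates: `(∇ reTrigPoly S c x)ⱼ = ∂ⱼ reTrigPoly S c x`. [folklore] -/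
theorem gradient_reTrigPoly_apply (S : Finset (d → ℤ)) (c : (d → ℤ) → ℂ) (x : UnitAddTorus d) (j : d) :
    Torus.gradient (reTrigPoly S c) x j = partialDeriv j (reTrigPoly S c) x := by
  have h := inner_gradient_eq_sum_mul_partialDeriv ((isSmooth_reTrigPoly S c).isContDiff (by simp))
    (EuclideanSpace.single j (1 : ℝ)) x
  rw [EuclideanSpace.inner_single_left] at h
  simpa [EuclideanSpace.single, PiLp.single_apply] using h

/-- Pointwise gradient norm in coordinates: `‖∇ reTrigPoly S c x‖² = ∑ⱼ (∂ⱼ reTrigPoly S c x)²`. [folklore] -/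
theorem norm_gradient_reTrigPoly_sq (S : Finset (d → ℤ)) (c : (d → ℤ) → ℂ) (x : UnitAddTorus d) :
    ‖Torus.gradient (reTrigPoly S c) x‖ ^ 2 = ∑ j, partialDeriv j (reTrigPoly S c) x ^ 2 := by
  rw [EuclideanSpace.norm_sq_eq]
  refine Finset.sum_congr rfl fun j _ => ?_
  rw [gradient_reTrigPoly_apply, Real.norm_eq_abs, sq_abs]

/-- **Spectral gradient norm of a real scalar trigonometric polynomial**:
`∫ ‖∇ reTrigPoly S c‖² = 4π² ∑_{k∈S} |k|² |c k|²` (conjugate-symmetric `c`, symmetric `S`;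
`∂ⱼ ↦ 2πi kⱼ` and the finite Parseval identity; Grafakos 2014, Prop. 3.2.6 (8), 3.2.7 (3)). [cite: Grafakos2014, Prop. 3.2.6 (8)] -/
theorem integral_norm_sq_gradient_reTrigPoly {S : Finset (d → ℤ)} (hS : ∀ k ∈ S, -k ∈ S)
    {c : (d → ℤ) → ℂ} (hc : IsConjSymmScalar c) :
    ∫ x, ‖Torus.gradient (reTrigPoly S c) x‖ ^ 2 =
      4 * Real.pi ^ 2 * ∑ k ∈ S, freqNormSq k * ‖c k‖ ^ 2 := by
  simp_rw [norm_gradient_reTrigPoly_sq, partialDeriv_reTrigPoly]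
  rw [integral_finsetSum _ fun j _ => ?_]
  · simp_rw [integral_sq_reTrigPoly hS (hc.deriv _)]
    rw [Finset.sum_comm, Finset.mul_sum]
    refine Finset.sum_congr rfl fun k _ => ?_
    simp only [smul_eq_mul, norm_mul, Complex.norm_real, Complex.norm_I, Complex.norm_intCast,
      Real.norm_eq_abs, Complex.norm_ofNat, mul_one, freqNormSq, Finset.sum_mul, Finset.mul_sum]
    refine Finset.sum_congr rfl fun j _ => ?_
    rw [abs_of_pos Real.pi_pos, mul_pow, mul_pow, mul_pow, sq_abs]
    ring
  · exact ((continuous_reTrigPoly S _).pow 2).integrable_unitAddTorus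

/-- **The Laplacian acts diagonally**: `Δ reTrigPoly S c = reTrigPoly S (-4π²|k|² c)`
(`Δ = ∑ⱼ ∂ⱼ∂ⱼ` on smooth functions, `Torus.laplacian_eq_sum_partialDeriv_partialDeriv`, and
`∂ⱼ ↦ 2πi kⱼ`). [folklore] -/
theorem laplacian_reTrigPoly (S : Finset (d → ℤ)) (c : (d → ℤ) → ℂ) (x : UnitAddTorus d) :
    Torus.laplacian (reTrigPoly S c) x =
      reTrigPoly S (fun k => ((-(4 * Real.pi ^ 2 * freqNormSq k) : ℝ) : ℂ) • c k) x := by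
  rw [laplacian_eq_sum_partialDeriv_partialDeriv (isSmooth_reTrigPoly S c)]
  have h1 : ∀ j, partialDeriv j (partialDeriv j (reTrigPoly S c)) x =
      reTrigPoly S (fun k => (2 * Real.pi * Complex.I * (k j)) • ((2 * Real.pi * Complex.I * (k j)) • c k)) x := by
    intro j
    rw [show partialDeriv j (reTrigPoly S c) = reTrigPoly S (fun k => (2 * Real.pi * Complex.I * (k j)) • c k)
      from funext (partialDeriv_reTrigPoly S c j), partialDeriv_reTrigPoly]
  have key : ∀ k : d → ℤ,
      ∑ j, (2 * Real.pi * Complex.I * (k j)) • ((2 * Real.pi * Complex.I * (k j)) • c k) =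
        (((-(4 * Real.pi ^ 2 * freqNormSq k)) : ℝ) : ℂ) • c k := by
    intro k
    simp_rw [smul_smul, ← Finset.sum_smul]
    congr 1
    simp only [freqNormSq]
    push_cast
    rw [Finset.mul_sum, ← Finset.sum_neg_distrib]
    refine Finset.sum_congr rfl fun j _ => ?_
    linear_combination (2 * (Real.pi : ℂ) * (k j : ℂ)) ^ 2 * Complex.I_mul_I
  simp_rw [h1, reTrigPoly_eq_sum]
  rw [Finset.sum_comm]
  refine Finset.sum_congr rfl fun k _ => ?_
  rw [← Complex.re_sum, ← Finset.mul_sum, key]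

/-- **Single modes are eigenfunctions of the Laplacian**:
`Δ reTrigPoly {m} c = -4π²|m|² reTrigPoly {m} c`; in particular for the cosine and sine modes
`Re e_{-k}`, `Im e_{-k}` (Grafakos 2014, Prop. 3.2.6 (8)). [cite: Grafakos2014, Prop. 3.2.6 (8)] -/
theorem laplacian_reTrigPoly_singleton (m : d → ℤ) (c : (d → ℤ) → ℂ) (x : UnitAddTorus d) :
    Torus.laplacian (reTrigPoly {m} c) x = -(4 * Real.pi ^ 2 * freqNormSq m) * reTrigPoly {m} c x := by
  rw [laplacian_reTrigPoly, reTrigPoly_singleton_apply, reTrigPoly_singleton_apply, smul_eq_mul,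
    mul_left_comm, Complex.re_ofReal_mul]

end ReTrigPoly

/-! ## The Fourier truncation of a real scalar -/

section Truncate

variable [DecidableEq d]

/-- The **Fourier truncation** `P_N θ = Re ∑_{|k| ≤ N} θ̂(k) e_k` of a real scalar `θ : T^d → ℝ`,
`θ̂ = 𝓕((↑) ∘ θ)` (Robinson–Rodrigo–Sadowski 2016, §4.1 / Lemma 4.1, the projections `P_n`, here
with the mean mode kept; Grafakos 2014, §3.1.1, square partial sums). Junk: for non-integrable
`θ` all coefficients vanish and `P_N θ = 0`. [cite: RobinsonRodrigoSadowski2016, Lemma 4.1] -/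
def scalarTruncate (N : ℕ) (θ : UnitAddTorus d → ℝ) : UnitAddTorus d → ℝ :=
  reTrigPoly (freqBall N) fun k => mFourierCoeff (fun x => (θ x : ℂ)) k

/-- Truncations are smooth. [folklore] -/
theorem isSmooth_scalarTruncate (N : ℕ) (θ : UnitAddTorus d → ℝ) : IsSmooth (scalarTruncate N θ) :=
  isSmooth_reTrigPoly _ _

/-- Truncations are continuous. [folklore] -/
theorem continuous_scalarTruncate (N : ℕ) (θ : UnitAddTorus d → ℝ) :
    Continuous (scalarTruncate N θ) :=
  continuous_reTrigPoly _ _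

/-- Truncations lie in every `L^p`. [folklore] -/
theorem memLp_scalarTruncate (N : ℕ) (θ : UnitAddTorus d → ℝ) (p : ℝ≥0∞) :
    MemLp (scalarTruncate N θ) p volume :=
  memLp_reTrigPoly _ _ p

/-- The truncation viewed in `ℂ` is the complex partial Fourier sum:
`(P_N θ x : ℂ) = ∑_{|k|≤N} θ̂(k) e_k(x)`. [folklore] -/
theorem ofReal_scalarTruncate (N : ℕ) (θ : UnitAddTorus d → ℝ) (x : UnitAddTorus d) :
    ((scalarTruncate N θ x : ℝ) : ℂ) =
      trigPoly (freqBall N) (fun k => mFourierCoeff (fun x => (θ x : ℂ)) k) x :=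
  ofReal_reTrigPoly neg_mem_freqBall_of_mem (isConjSymmScalar_mFourierCoeff θ) x

/-- **The gradient of the truncation in cosine and sine modes**:
`∇P_N θ = ∑_{|k|≤N} (Re θ̂(k) ∇Re e_{-k} + Im θ̂(k) ∇Im e_{-k})`. [folklore] -/
theorem gradient_scalarTruncate_eq_sum_re_im (N : ℕ) (θ : UnitAddTorus d → ℝ) (x : UnitAddTorus d) :
    Torus.gradient (scalarTruncate N θ) x =
      ∑ k ∈ freqBall N, ((mFourierCoeff (fun x => (θ x : ℂ)) k).re •
          Torus.gradient (reTrigPoly {-k} fun _ => 1) x +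
        (mFourierCoeff (fun x => (θ x : ℂ)) k).im •
          Torus.gradient (reTrigPoly {-k} fun _ => -Complex.I) x) :=
  gradient_reTrigPoly_eq_sum_re_im _ _ x

/-- `‖P_N θ‖²_{L²} = ∑_{|k|≤N} |θ̂(k)|²`. [cite: Grafakos2014, Prop. 3.2.7 (3)] -/
theorem integral_sq_scalarTruncate (N : ℕ) (θ : UnitAddTorus d → ℝ) :
    ∫ x, scalarTruncate N θ x ^ 2 = ∑ k ∈ freqBall N, ‖mFourierCoeff (fun x => (θ x : ℂ)) k‖ ^ 2 :=
  integral_sq_reTrigPoly neg_mem_freqBall_of_mem (isConjSymmScalar_mFourierCoeff θ)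

/-- `‖∇P_N θ‖²_{L²} = 4π² ∑_{|k|≤N} |k|² |θ̂(k)|²`. [cite: Grafakos2014, Prop. 3.2.6 (8)] -/
theorem integral_norm_sq_gradient_scalarTruncate (N : ℕ) (θ : UnitAddTorus d → ℝ) :
    ∫ x, ‖Torus.gradient (scalarTruncate N θ) x‖ ^ 2 =
      4 * Real.pi ^ 2 * ∑ k ∈ freqBall N, freqNormSq k * ‖mFourierCoeff (fun x => (θ x : ℂ)) k‖ ^ 2 :=
  integral_norm_sq_gradient_reTrigPoly neg_mem_freqBall_of_mem (isConjSymmScalar_mFourierCoeff θ)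

omit [DecidableEq d] in
/-- **Parseval for a real scalar**: `∑_k |θ̂(k)|² = ∫ θ²` for `θ ∈ L²(T^d; ℝ)`
(`Torus.hasSum_sq_norm_mFourierCoeff` for `(↑) ∘ θ`; Grafakos 2014, Prop. 3.2.7 (3)). [cite: Grafakos2014, Prop. 3.2.7 (3)] -/
theorem hasSum_sq_norm_mFourierCoeff_ofReal {θ : UnitAddTorus d → ℝ} (hθ : MemLp θ 2 volume) :
    HasSum (fun k : d → ℤ => ‖mFourierCoeff (fun x => (θ x : ℂ)) k‖ ^ 2) (∫ x, θ x ^ 2) := by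
  have h := hasSum_sq_norm_mFourierCoeff (g := fun x => (θ x : ℂ)) hθ.ofReal
  have e : ∫ x, ‖((θ x : ℝ) : ℂ)‖ ^ 2 = ∫ x, θ x ^ 2 :=
    integral_congr_ae (ae_of_all _ fun x => by simp [Complex.norm_real, sq_abs])
  rwa [e] at h

/-- Bessel's inequality for the truncation: `∑_{|k|≤N} |θ̂(k)|² ≤ ∫ θ²` for `θ ∈ L²`. [folklore] -/
theorem sum_sq_norm_mFourierCoeff_le_integral_sq {θ : UnitAddTorus d → ℝ} (hθ : MemLp θ 2 volume)
    (N : ℕ) : ∑ k ∈ freqBall N, ‖mFourierCoeff (fun x => (θ x : ℂ)) k‖ ^ 2 ≤ ∫ x, θ x ^ 2 :=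
  sum_le_hasSum _ (fun _ _ => sq_nonneg _) (hasSum_sq_norm_mFourierCoeff_ofReal hθ)

/-- **The Parseval tail identity**: for `θ ∈ L²(T^d; ℝ)`,
`∫ (θ - P_N θ)² = ∫ θ² - ∑_{|k|≤N} |θ̂(k)|²` (the coefficients of `θ - P_N θ` are `θ̂(k)` off the
ball and `0` on it; Robinson–Rodrigo–Sadowski 2016, Lemma 4.1 and p. 74). [cite: RobinsonRodrigoSadowski2016, Lemma 4.1] -/
theorem integral_sq_sub_scalarTruncate {θ : UnitAddTorus d → ℝ} (hθ : MemLp θ 2 volume) (N : ℕ) :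
    ∫ x, (θ x - scalarTruncate N θ x) ^ 2 =
      (∫ x, θ x ^ 2) - ∑ k ∈ freqBall N, ‖mFourierCoeff (fun x => (θ x : ℂ)) k‖ ^ 2 := by
  set a : (d → ℤ) → ℂ := fun k => mFourierCoeff (fun x => (θ x : ℂ)) k with ha
  -- the complex difference `g = θ - P_N θ` and its coefficients
  set g : UnitAddTorus d → ℂ := fun x => ((θ x - scalarTruncate N θ x : ℝ) : ℂ) with hg
  have hgL : MemLp g 2 volume := (hθ.sub (memLp_scalarTruncate N θ 2)).ofReal
  have hg' : g = (fun x => (θ x : ℂ)) - trigPoly (freqBall N) a := by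
    funext x
    simp only [hg, ha, Pi.sub_apply, Complex.ofReal_sub, ofReal_scalarTruncate]
  have hcoeff : ∀ k, mFourierCoeff g k = if k ∈ freqBall N then 0 else a k := fun k => by
    rw [hg', mFourierCoeff_sub (hθ.integrable one_le_two).ofReal (isSmooth_trigPoly _ _).integrable,
      mFourierCoeff_trigPoly]
    split_ifs <;> simp [ha]
  -- Parseval for `g`, and for `θ` minus the finite part
  have h1 : HasSum (fun k => ‖mFourierCoeff g k‖ ^ 2) (∫ x, (θ x - scalarTruncate N θ x) ^ 2) := by
    have h := hasSum_sq_norm_mFourierCoeff hgL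
    have e : ∫ x, ‖g x‖ ^ 2 = ∫ x, (θ x - scalarTruncate N θ x) ^ 2 :=
      integral_congr_ae (ae_of_all _ fun x => by
        show ‖((θ x - scalarTruncate N θ x : ℝ) : ℂ)‖ ^ 2 = _
        rw [Complex.norm_real, Real.norm_eq_abs, sq_abs])
    rwa [e] at h
  have h2 : HasSum (fun k => ‖a k‖ ^ 2 - if k ∈ freqBall N then ‖a k‖ ^ 2 else 0)
      ((∫ x, θ x ^ 2) - ∑ k ∈ freqBall N, ‖a k‖ ^ 2) := by
    refine (hasSum_sq_norm_mFourierCoeff_ofReal hθ).sub ?_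
    have h := hasSum_sum_of_ne_finset_zero (f := fun k => if k ∈ freqBall N then ‖a k‖ ^ 2 else 0)
      (s := freqBall N) (L := SummationFilter.unconditional _) (fun k hk => if_neg hk)
    rwa [Finset.sum_congr rfl fun k hk => if_pos hk] at h
  have h3 : (fun k => ‖mFourierCoeff g k‖ ^ 2) =
      fun k => ‖a k‖ ^ 2 - if k ∈ freqBall N then ‖a k‖ ^ 2 else 0 := by
    funext k
    rw [hcoeff k]
    split_ifs <;> simp
  rw [h3] at h1
  exact h1.unique h2

/-- The truncation error is bounded by the energy: `∫ (θ - P_N θ)² ≤ ∫ θ²` for `θ ∈ L²`. [folklore] -/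
theorem integral_sq_sub_scalarTruncate_le {θ : UnitAddTorus d → ℝ} (hθ : MemLp θ 2 volume) (N : ℕ) :
    ∫ x, (θ x - scalarTruncate N θ x) ^ 2 ≤ ∫ x, θ x ^ 2 := by
  rw [integral_sq_sub_scalarTruncate hθ]
  linarith [Finset.sum_nonneg fun k (_ : k ∈ freqBall N) =>
    sq_nonneg ‖mFourierCoeff (fun x => (θ x : ℂ)) k‖]

/-- **`P_N θ → θ` in `L²`**, squared form: `∫ (θ - P_N θ)² → 0` for `θ ∈ L²(T^d; ℝ)` (the
partial sums over the exhausting balls `freqBall N` converge to the Parseval sum;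
Robinson–Rodrigo–Sadowski 2016, Lemma 4.1, p. 74). [cite: RobinsonRodrigoSadowski2016, Lemma 4.1] -/
theorem tendsto_integral_sq_sub_scalarTruncate {θ : UnitAddTorus d → ℝ} (hθ : MemLp θ 2 volume) :
    Tendsto (fun N => ∫ x, (θ x - scalarTruncate N θ x) ^ 2) atTop (𝓝 0) := by
  simp_rw [integral_sq_sub_scalarTruncate hθ]
  have h := ((hasSum_sq_norm_mFourierCoeff_ofReal hθ).comp tendsto_freqBall_atTop)
  have := (tendsto_const_nhds (x := ∫ x, θ x ^ 2)).sub h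
  rwa [sub_self] at this

end Truncate

end Torus

end Literature.Analysis.FunctionSpaces
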